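import Mathlib
import Summits.ValiantsHypothesis.ValiantsHypothesis.Theorems.BarrierLeverSuccinctHittingSetsForVPPrincipalMinorsTwoFull
import HarnessLib

/-!
# Crux `BarrierLever.DefinableEquations` (stmt-ValiantsHypothesis-8745) / item 8749
`SingleSizeEquations` — the CATALECTICANT WALL AT THE OPEN RUNG: no Boolean-sum witness at `b ≥ 2`
is a principal catalecticant minor, of ANY size

Seat val-np-p5 g18 (docket 8745/8746/8749). In the crux's own currency — a witness of
`SingleSizeEquations` at `(n, b)` is a Boolean sum `E = boolSum H ≠ 0` in the `N = C(2n,n)` coefficient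
variables vanishing at `coeff(f)` for every `f ∈ SmallCircuits ℂ n b` — this file records what the
14610-side row landed today (`…PrincipalMinorsTwoFull`: the central-binomial witness of size `≤ n²`,
FFT product tree + Newton iteration) says about the SHAPE of such a witness:

* `boolSum_witness_not_principalMinor_two_all` : for `n ≥ 8192` and EVERY `b ≥ 2`, NO witness `E`
  (any `q`, any size and degree of `H`) is, as a function of the coefficient vector, a principal
  catalecticant minor `f ↦ det [coeff_{u_i+u_j} f]_{i,j ∈ ι}` (`u` injective, `2|u_i| ≤ n`; ANY
  size, any mixture of row degrees) — the tree's `boolSum_witness_not_principalMinor` had this for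
  `b ≥ 3` and `boolSum_witness_not_principalMinor_two` only for minors of size `< n`;
* `principalMinor_boolSum_not_equation_two` : level form.

So the door "E a principal catalecticant minor" of the b = 2 door table (memos LANDSCAPE-8749-g16 §5
/ g17 §0) is now CLOSED at the open rung for every size.

Honest framing: a WALL (it excludes witnesses of a specific algebraic shape); the verdict on 8745/8749
is unchanged (OPEN at `b = 2`, Chatterjee–Tengse 2023 §1.3 direction 2); nothing here bears on
`VP ≠ VNP`.

References: [ForbesShpilkaVolk2018] §1.2 (rank methods are algebraically natural), Question 6;
[ChatterjeeTengse2023] §1.3.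
-/

-- layout Summits/ValiantsHypothesis/ValiantsHypothesis forces the duplicated namespace component
set_option linter.dupNamespace false

noncomputable section

namespace Summit.ValiantsHypothesis.ValiantsHypothesis.Theorems.BarrierLeverDefinableEquations

open Literature.Barriers.ValiantsHypothesis Literature.Computability.AlgebraicComplexity MvPolynomial
open Summit.ValiantsHypothesis.ValiantsHypothesis.Theorems.BarrierLever.SuccinctHittingSetsForVP

namespace CatalecticantWall

/-- **At the open rung: no Boolean-sum witness at `(n, b)`, `b ≥ 2`, `n ≥ 8192`, is a principal
catalecticant minor** (ANY size, any selection of rows `u_i` with `2|u_i| ≤ n`).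
[cite: ForbesShpilkaVolk2018, §1.2] -/
theorem boolSum_witness_not_principalMinor_two_all {n b q : ℕ} (hn : 8192 ≤ n) (hb : 2 ≤ b)
    (H : MvPolynomial (degLEMonomials n ⊕ Fin q) ℂ) (hne : boolSum H ≠ 0)
    (hvan : ∀ f ∈ SmallCircuits ℂ n b,
      MvPolynomial.eval (coeffVector (degLEMonomials n) f) (boolSum H) = 0) :
    ¬ ∃ (ι : Type) (_ : Fintype ι) (_ : DecidableEq ι) (u : ι → (Fin n →₀ ℕ)),
        Function.Injective u ∧ (∀ i, 2 * (u i).degree ≤ n) ∧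
        ∀ f : MvPolynomial (Fin n) ℂ,
          MvPolynomial.eval (coeffVector (degLEMonomials n) f) (boolSum H) =
            (Matrix.of fun i j : ι => MvPolynomial.coeff (u i + u j) f).det := by
  intro hshape
  obtain ⟨f, hf, hf0⟩ := principalMinorsHit_of_two_le hn hb (boolSum H) hshape hne
  exact hf0 (hvan f hf)

/-- **Level form at the open rung** (quantifiers of item 8749 at one rung): for `b ≥ 2` there is NO
level `a`, threshold `n₀ ≥ 8192` and family of Boolean sums witnessing `SingleSizeEquations` at
exponent `b` whose members are principal catalecticant minors — whatever `a`, `q ≤ N^a`, size and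
degree. Stated as: any such family member at `n ≥ 8192` fails to vanish on `SmallCircuits ℂ n b`.
[cite: ForbesShpilkaVolk2018, §1.2] -/
theorem principalMinor_boolSum_not_equation_two {n b q : ℕ} (hn : 8192 ≤ n) (hb : 2 ≤ b)
    (H : MvPolynomial (degLEMonomials n ⊕ Fin q) ℂ)
    (hshape : ∃ (ι : Type) (_ : Fintype ι) (_ : DecidableEq ι) (u : ι → (Fin n →₀ ℕ)),
        Function.Injective u ∧ (∀ i, 2 * (u i).degree ≤ n) ∧
        ∀ f : MvPolynomial (Fin n) ℂ,
          MvPolynomial.eval (coeffVector (degLEMonomials n) f) (boolSum H) =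
            (Matrix.of fun i j : ι => MvPolynomial.coeff (u i + u j) f).det)
    (hne : boolSum H ≠ 0) :
    ∃ f ∈ SmallCircuits ℂ n b,
      MvPolynomial.eval (coeffVector (degLEMonomials n) f) (boolSum H) ≠ 0 :=
  principalMinorsHit_of_two_le hn hb (boolSum H) hshape hne

end CatalecticantWall

end Summit.ValiantsHypothesis.ValiantsHypothesis.Theorems.BarrierLeverDefinableEquations

end
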